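import Summits.CriticalPhenomena.PercolationContinuityZ3.Theorems.PercNearOneGluingNoHeavyQuantAtMostOne
import Summits.CriticalPhenomena.PercolationContinuityZ3.Theorems.PercNearOneGluingNoHeavyQuantRootDecGiantsSmalls
import HarnessLib

/-!
# QUANT lane R8, Conjecture DIB\* — CONDITIONING ON A PAIRWISE-COMPLETING SET (the B/S identity of the lead g19)

builds on p205010 (kernel theorem, internal audit signed; external expert review pending)

Support file (`--supports stmt-CriticalPhenomena-4575`), QUANT lane lead (gen 19); memo
`run/shared/lean/prim/quant/prim-quant-lead-g19/LEAD-NOTES-G19.md` N37.  Theorems only; local notation; no sorries, standard axioms.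

Let `T` be a finset of blobs any two of which COMPLETE at the sure part `s` (`j + 1 ≤ s + a k + a l`, `k ≠ l` in `T`; e.g. all blobs
with `2·a k ≥ j − s + 1`, `pairSet_of_twice`).  Conditioning on the whole of `T` is exact and cheap: if two blobs of `T` are open the
term is `1`; if exactly `k ∈ T` is open the REST `a|_{T↦0}` must supply `j + 1 − s − a k`; if no blob of `T` is open the rest must
supply `j + 1 − s`.

* `Quant.RootDec.term_eq_pairSet` — **THE B/S IDENTITY**:
  `TERM[s,a,g,j] = (1 − AMO[T, 1−g]) + Σ_{k∈T} g k·∏_{l∈T∖k}(1 − g l)·TERM[s + a k, a|_{T↦0}, g, j] + ∏_{l∈T}(1 − g l)·TERM[s, a|_{T↦0}, g, j]`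
  (induction on `T` by `term_cond`; the branch '`k₀` open' is the exact giants ⊗ smalls factorisation `one_sub_term_eq_giants` — every
  other blob of `T` is then a giant; recombination by `IndepBlob.amo_insert`).
* `Quant.RootDec.term_ge_of_pairSet` — the identity as a CERTIFICATE: any lower bounds `z k` (`k ∈ T`) and `z₀` for the rest's terms
  give `(1 − AMO[T,1−g]) + Σ_k g k ∏_{T∖k}(1−g)·z k + ∏_T(1−g)·z₀ ≤ TERM[s,a,g,j]`.  With `z = z₀ = 0` this is typer g20's
  `term_ge_one_sub_amo`; with `T = {k}` it is rule φ (`term_cond`) followed by nothing.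
* `Quant.RootDec.pairSet_of_twice` — the blobs with `j < s + 2·a k` (more than half the residual need) pairwise complete.

Why (N37): on the residual class of T-DIB (lumpy core with a non-completing pair, README V222 (d)) the single split on the largest blob
(ARCHITECTURE FS) certifies every instance with adversarial margin ≈ 0.11(1−x); conditioning on ALL blobs of size `> j/2` at once and
bounding the rest's terms by kernel rules only (Cantelli `term_ge_of_cantelli`, Markov `term_ge_of_markov`, giants ⊗ smalls
`term_ge_of_giants_smalls`) certifies every instance found (82 627 grid + adversarial climbs incl. `x → 1`, `j ≤ 200`) with margin
`≥ 0.36(1−x)`, and with the rest entering ONLY through its total size, mean and variance (margin ≥ 0.098(1−x)).  [this work];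
the gluing rows served [cite: KozmaNitzan2024, Conjecture 3 (p. 15)]; product weights [cite: Grimmett1999, §1.3 p. 10].
-/

namespace Summit.CriticalPhenomena.PercolationContinuityZ3.Theorems

namespace Quant

namespace RootDec

open Finset

variable {κ : Type} [Fintype κ] [DecidableEq κ]

/-- product-Bernoulli weight of the set `W` of open blobs (as in `…QuantRootReduction`) -/
local notation3 "wt[" g ", " W "]" => ∏ k, (if k ∈ (W : Finset κ) then (g : κ → ℝ) k else 1 - (g : κ → ℝ) k)

/-- the TERM tail `P(s + Σ_{k open} a k ≥ j+1)` (as in `…QuantRootReduction`) -/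
local notation3 "TERM[" s ", " a ", " g ", " j "]" =>
  ∑ W : Finset κ, wt[g, W] * (if (j : ℕ) + 1 ≤ (s : ℕ) + ∑ k ∈ W, (a : κ → ℕ) k then (1 : ℝ) else 0)

/-- probability that at most one blob of `T` is open, closure probabilities `q` (as in `Quant.IndepBlob`) -/
local notation3 "AMO[" T ", " q "]" =>
  (∏ k ∈ (T : Finset κ), (q : κ → ℝ) k) + ∑ k ∈ (T : Finset κ), (1 - (q : κ → ℝ) k) * ∏ l ∈ (T : Finset κ).erase k, (q : κ → ℝ) l

/-- sizes with the blobs of `T` emptied -/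
local notation3 "off[" a ", " T "]" => (fun i => if i ∈ (T : Finset κ) then 0 else (a : κ → ℕ) i)

/-! ### 1. Pairwise completion from sizes -/

omit [Fintype κ] [DecidableEq κ] in
/-- Blobs of more than half the residual need pairwise complete: `j < s + 2·a k` for every `k ∈ T` gives
`j + 1 ≤ s + a k + a l` for all `k ≠ l` in `T` (e.g. `T` = the blobs of size `> (j − s)/2`). [this work] -/
theorem pairSet_of_twice (s j : ℕ) (a : κ → ℕ) (T : Finset κ) (h : ∀ k ∈ T, j < s + 2 * a k) :
    ∀ k ∈ T, ∀ l ∈ T, k ≠ l → j + 1 ≤ s + a k + a l := by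
  intro k hk l hl _
  have hk' := h k hk
  have hl' := h l hl
  omega

/-! ### 2. The B/S identity -/

/-- **THE B/S IDENTITY (conditioning on a pairwise-completing set).**  For a finset `T` of blobs any two of which complete at the
sure part `s`:
`TERM[s,a,g,j] = (1 − AMO[T, 1−g]) + Σ_{k∈T} g k·(∏_{l∈T∖k}(1 − g l))·TERM[s + a k, a|_{T↦0}, g, j] + (∏_{l∈T}(1 − g l))·TERM[s, a|_{T↦0}, g, j]`.
[this work] -/
theorem term_eq_pairSet (g : κ → ℝ) (j s : ℕ) (T : Finset κ) :
    ∀ (a : κ → ℕ), (∀ k ∈ T, ∀ l ∈ T, k ≠ l → j + 1 ≤ s + a k + a l) →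
      TERM[s, a, g, j] = (1 - AMO[T, fun k => 1 - g k])
        + ∑ k ∈ T, g k * (∏ l ∈ T.erase k, (1 - g l)) * TERM[s + a k, off[a, T], g, j]
        + (∏ l ∈ T, (1 - g l)) * TERM[s, off[a, T], g, j] := by
  induction T using Finset.induction_on with
  | empty =>
    intro a _
    have e : off[a, (∅ : Finset κ)] = a := funext fun i => by simp
    simp only [Finset.prod_empty, Finset.sum_empty, add_zero, sub_self, zero_add, one_mul, e]
  | @insert k₀ T hk₀ ih =>
    intro a hpair
    -- notation: `a'` = `a` with `k₀` emptied; `a''` = `a` with `insert k₀ T` emptied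
    have hpairT : ∀ k ∈ T, ∀ l ∈ T, k ≠ l → j + 1 ≤ s + Function.update a k₀ 0 k + Function.update a k₀ 0 l := by
      intro k hk l hl hkl
      rw [Function.update_of_ne (fun h => hk₀ (h ▸ hk) : k ≠ k₀), Function.update_of_ne (fun h => hk₀ (h ▸ hl) : l ≠ k₀)]
      exact hpair k (Finset.mem_insert_of_mem hk) l (Finset.mem_insert_of_mem hl) hkl
    have eoff : off[Function.update a k₀ 0, T] = off[a, insert k₀ T] := by
      funext i
      by_cases hik : i = k₀
      · subst hik
        simp [hk₀]
      · simp [Finset.mem_insert, hik]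
    have ih' := ih (Function.update a k₀ 0) hpairT
    rw [eoff] at ih'
    -- inner sure parts `s + a' k = s + a k` on `T`
    have ih'' : TERM[s, Function.update a k₀ 0, g, j] = (1 - AMO[T, fun k => 1 - g k])
        + ∑ k ∈ T, g k * (∏ l ∈ T.erase k, (1 - g l)) * TERM[s + a k, off[a, insert k₀ T], g, j]
        + (∏ l ∈ T, (1 - g l)) * TERM[s, off[a, insert k₀ T], g, j] := by
      rw [ih']
      congr 2
      refine Finset.sum_congr rfl fun k hk => ?_
      rw [Function.update_of_ne (fun h => hk₀ (h ▸ hk) : k ≠ k₀)]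
    -- open branch: every blob of `T` is a giant at the sure part `s + a k₀`
    have hG : ∀ l ∈ T, j + 1 ≤ (s + a k₀) + Function.update a k₀ 0 l := by
      intro l hl
      have hl0 : l ≠ k₀ := fun h => hk₀ (h ▸ hl)
      rw [Function.update_of_ne hl0]
      exact hpair k₀ (Finset.mem_insert_self _ _) l (Finset.mem_insert_of_mem hl) hl0.symm
    have hopen : TERM[s + a k₀, Function.update a k₀ 0, g, j] =
        1 - (∏ l ∈ T, (1 - g l)) * (1 - TERM[s + a k₀, off[a, insert k₀ T], g, j]) := by
      have h := one_sub_term_eq_giants (s + a k₀) (Function.update a k₀ 0) g j T hG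
      rw [eoff] at h
      linarith
    -- assemble
    rw [term_cond s a g j k₀, hopen, ih'', IndepBlob.amo_insert T (fun k => 1 - g k) k₀ hk₀, Finset.sum_insert hk₀,
      Finset.erase_insert hk₀, Finset.prod_insert hk₀]
    have hsum : ∑ k ∈ T, g k * (∏ l ∈ (insert k₀ T).erase k, (1 - g l)) * TERM[s + a k, off[a, insert k₀ T], g, j] =
        (1 - g k₀) * ∑ k ∈ T, g k * (∏ l ∈ T.erase k, (1 - g l)) * TERM[s + a k, off[a, insert k₀ T], g, j] := by
      rw [Finset.mul_sum]
      refine Finset.sum_congr rfl fun k hk => ?_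
      have hk0 : k₀ ≠ k := fun h => hk₀ (h ▸ hk)
      rw [Finset.erase_insert_of_ne hk0, Finset.prod_insert (fun h => hk₀ (Finset.mem_of_mem_erase h))]
      ring
    rw [hsum]
    ring

/-! ### 3. The identity as a certificate -/

/-- **B/S CERTIFICATE.**  Gates in `[0,1]`; `T` pairwise completing at the sure part `s`; lower bounds `z k ≤ TERM[s + a k, a|_{T↦0}, g, j]`
(`k ∈ T`: only `k` of `T` is open, the rest must supply the remaining `j + 1 − s − a k`) and `z₀ ≤ TERM[s, a|_{T↦0}, g, j]` (no blob of `T` is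
open).  Then `(1 − AMO[T, 1−g]) + Σ_{k∈T} g k·∏_{T∖k}(1 − g)·z k + ∏_T(1 − g)·z₀ ≤ TERM[s, a, g, j]`.  The bounds may come from any TERM rule
(`term_ge_of_cantelli`, `term_ge_of_markov`, `term_ge_of_giants_smalls`, `prod_le_term_of_witness`, the capped DIB row …). [this work] -/
theorem term_ge_of_pairSet (g : κ → ℝ) (j s : ℕ) (hg : ∀ k, 0 ≤ g k ∧ g k ≤ 1) (T : Finset κ) (a : κ → ℕ)
    (hpair : ∀ k ∈ T, ∀ l ∈ T, k ≠ l → j + 1 ≤ s + a k + a l) (z : κ → ℝ) (z₀ : ℝ)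
    (hz : ∀ k ∈ T, z k ≤ TERM[s + a k, off[a, T], g, j]) (hz₀ : z₀ ≤ TERM[s, off[a, T], g, j]) :
    (1 - AMO[T, fun k => 1 - g k]) + ∑ k ∈ T, g k * (∏ l ∈ T.erase k, (1 - g l)) * z k
      + (∏ l ∈ T, (1 - g l)) * z₀ ≤ TERM[s, a, g, j] := by
  rw [term_eq_pairSet g j s T a hpair]
  have hq : ∀ l, 0 ≤ 1 - g l := fun l => sub_nonneg.2 (hg l).2
  have h1 : ∑ k ∈ T, g k * (∏ l ∈ T.erase k, (1 - g l)) * z k ≤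
      ∑ k ∈ T, g k * (∏ l ∈ T.erase k, (1 - g l)) * TERM[s + a k, off[a, T], g, j] :=
    Finset.sum_le_sum fun k hk => mul_le_mul_of_nonneg_left (hz k hk)
      (mul_nonneg (hg k).1 (Finset.prod_nonneg fun l _ => hq l))
  have h2 : (∏ l ∈ T, (1 - g l)) * z₀ ≤ (∏ l ∈ T, (1 - g l)) * TERM[s, off[a, T], g, j] :=
    mul_le_mul_of_nonneg_left hz₀ (Finset.prod_nonneg fun l _ => hq l)
  linarith

/-- **B/S certificate, floor form.**  Same hypotheses; if moreover
`x ≤ (1 − AMO[T, 1−g]) + Σ_{k∈T} g k·∏_{T∖k}(1 − g)·z k + ∏_T(1 − g)·z₀` then `x ≤ TERM[s, a, g, j]`. [this work] -/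
theorem term_ge_of_pairSet' (g : κ → ℝ) (j s : ℕ) (hg : ∀ k, 0 ≤ g k ∧ g k ≤ 1) (T : Finset κ) (a : κ → ℕ)
    (hpair : ∀ k ∈ T, ∀ l ∈ T, k ≠ l → j + 1 ≤ s + a k + a l) (z : κ → ℝ) (z₀ x : ℝ)
    (hz : ∀ k ∈ T, z k ≤ TERM[s + a k, off[a, T], g, j]) (hz₀ : z₀ ≤ TERM[s, off[a, T], g, j])
    (hx : x ≤ (1 - AMO[T, fun k => 1 - g k]) + ∑ k ∈ T, g k * (∏ l ∈ T.erase k, (1 - g l)) * z k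
      + (∏ l ∈ T, (1 - g l)) * z₀) : x ≤ TERM[s, a, g, j] :=
  hx.trans (term_ge_of_pairSet g j s hg T a hpair z z₀ hz hz₀)

end RootDec

end Quant

end Summit.CriticalPhenomena.PercolationContinuityZ3.Theorems
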